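import Summits.KontsevichZagierPeriods.KontsevichZagierPeriods.Theorems.LinRedNormalFormArrangementNormalFormStubRebaseSimplePosOnePosParThinQuad

/-!
# Stub `stub_rebaseSimplePosOnePos` (crux `ArrangementNormalForm`, line `janus-bands`) —
part `ParThinQuadCell`: every product cell from `HU` and `HQ` (any base dimension)

Continuation of part `ParThinQuad`. For the data of `Hpar` (parallel transverse bands, letter
`0`, common slope `s ≠ 0`, base pole `1/(y − ℓ₂(x'))`) over a product cell
`{x'-rows M₀} × (ylo(x'), yhi(x'))` and a rational `ε > 0`:
* `RebasePos.good_parCell_of_thinQuad` — with non-degenerate `y`-range and the pole outside it: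
  the pole lies on one side of the range over the whole `x'`-cell (`pole_one_side`); the near
  side is `RebasePos.good_parCell_nearSide`; on the far side the cut `w = ε h` (rule 1a) leaves
  a part `ε h ≤ w` closed by `⌈|s|/ε⌉ + 1` level splits (`RebasePos.good_parLevel`) and a THIN
  part handed to `RebasePos.good_parCell_far_thin` (quadruple point `HQ` / away from the pole
  `HU` / no triple point);
* `RebasePos.good_parCell_of_thinQuad'` — the same without the two side hypotheses (degenerate
  `x'`-factor: zero integrand; `pole_outside`; one cut along `yhi = ylo`);
* `RebasePos.good_par_of_thinQuad` — over any bounded base cell (`rebaseSimplePos_par_cells`),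
  registered as `rebaseSimplePos_par_of_thinQuad`: the residual hypothesis `Hpar` of the
  one-fibre rebase holds as soon as, for some rational `ε > 0`, the THIN (`w < ε h`) FAR-SIDE
  product cells with non-degenerate `y`-range either at distance `≥ δ > 0` from the pole and with
  a triple point on the closed cell (`HU`), or with a quadruple point on the closed cell (`HQ`),
  are congruent to the subgroup generated by `GG B 2 1`;
* `rebaseSimplePosOnePos_of_thinQuad'` — consequently the stub `stub_rebaseSimplePosOnePos`
  (`GS (b+2) 1 → closure (GG (b+2) 2 1 ∪ JJ (b+2) 2 ∪ JD (b+3))` modulo `KZ.relations`) holds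
  under a rational `ε > 0` and the residual hypotheses `HUQ` (thin far-side triple cells, `U` or
  `Q`, at `B = b + 2`), `Hdthick`, `Hdfar` (double corners, verbatim from part `Flats`):
  `rebaseSimplePosOnePos_of_triple'` fed with `RebasePos.good_parCell_of_thinQuad'`.

References: M. Kontsevich, D. Zagier, *Periods* (2001), §1.2, rules (1a), (1b), (2).
-/

noncomputable section

open Set MeasureTheory MvPolynomial
open Literature.NumberTheory.Transcendental Literature.ModelTheory.ExponentialFields

namespace Summit.KontsevichZagierPeriods.ArrangementNormalForm.JanusBands

namespace RebasePos

open SeparatePos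

section ThinQuadCell

variable {B m m' m₀ : ℕ} (L : Fin m → (Fin B → ℚ) × ℚ) (e : Fin m → ℕ) (ℓ₁ ℓ₂ : (Fin B → ℚ) × ℚ)

/-- **A product cell from `HU` and `HQ`** (any base dimension, any rational `ε > 0`). Data of
`Hpar` over a product cell (`hsec`) with non-degenerate `y`-range (`hne`) and the pole outside
it (`hpole`): the pole lies on one side (`pole_one_side`); the near side is
`good_parCell_nearSide`; on the far side the cut `w = ε h` (rule 1a) leaves level splits
(`ε h ≤ w`, `good_parLevel` with `N = ⌈|s|/ε⌉`) and a thin cell (`good_parCell_far_thin`). -/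
theorem good_parCell_of_thinQuad (ε : ℚ) (hε : 0 < ε) (s : KZ.IntegralRep (B + 1 + 1)) (M : Fin m' → (Fin (B + 1) → ℚ) × ℚ)
    (M₀ : Fin m₀ → (Fin B → ℚ) × ℚ) (ylo yhi : (Fin B → ℚ) × ℚ) (p : MvPolynomial (Fin B) ℚ)
    (u v : (Fin (B + 1) → ℚ) × ℚ) (hbd : Bornology.IsBounded s.domain)
    (hdom : s.domain = gDom B 1 m' M (fun _ => Sum.inr u) (fun _ => Sum.inr v))
    (hint : EqOn s.integrand (glit B 1 p L e ℓ₁ ℓ₂ 0 1 (fun _ => some 0)) s.domain)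
    (hu : u.1 (Fin.last B) ≠ 0) (hpar : u.1 (Fin.last B) = v.1 (Fin.last B))
    (hcell : ∀ z : Fin (B + 1 + 1) → ℝ, (∀ j, 0 < affF B 1 (M j) z) → 0 < affF B 1 u z ∧ affF B 1 u z < affF B 1 v z)
    (hsec : ∀ z : Fin (B + 1 + 1) → ℝ, (∀ j, 0 < affF B 1 (M j) z) ↔ ((∀ j, 0 < affB B 1 (M₀ j) z) ∧
      affB B 1 ylo z < z (Fin.castAdd 1 (Fin.last B)) ∧ z (Fin.castAdd 1 (Fin.last B)) < affB B 1 yhi z))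
    (hne : ∀ z : Fin (B + 1 + 1) → ℝ, (∀ j, 0 < affB B 1 (M₀ j) z) → affB B 1 ylo z < affB B 1 yhi z)
    (hpole : ∀ z : Fin (B + 1 + 1) → ℝ, (∀ j, 0 < affB B 1 (M₀ j) z) →
      affB B 1 ℓ₂ z ≤ affB B 1 ylo z ∨ affB B 1 yhi z ≤ affB B 1 ℓ₂ z)
    (HU : ∀ (m'' m₀' : ℕ) (s' : KZ.IntegralRep (B + 1 + 1)) (M' : Fin m'' → (Fin (B + 1) → ℚ) × ℚ)
      (M₀' : Fin m₀' → (Fin B → ℚ) × ℚ) (ylo' yhi' : (Fin B → ℚ) × ℚ), Bornology.IsBounded s'.domain →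
      s'.domain = gDom B 1 m'' M' (fun _ => Sum.inr u) (fun _ => Sum.inr v) →
      EqOn s'.integrand (glit B 1 p L e ℓ₁ ℓ₂ 0 1 (fun _ => some 0)) s'.domain →
      (∀ z : Fin (B + 1 + 1) → ℝ, (∀ j, 0 < affF B 1 (M' j) z) → 0 < affF B 1 u z ∧ affF B 1 u z < affF B 1 v z) →
      (∀ z : Fin (B + 1 + 1) → ℝ, (∀ j, 0 < affF B 1 (M' j) z) ↔ ((∀ j, 0 < affB B 1 (M₀' j) z) ∧
        affB B 1 ylo' z < z (Fin.castAdd 1 (Fin.last B)) ∧ z (Fin.castAdd 1 (Fin.last B)) < affB B 1 yhi' z)) →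
      (∀ z : Fin (B + 1 + 1) → ℝ, (∀ j, 0 < affB B 1 (M₀' j) z) → affB B 1 ylo' z < affB B 1 yhi' z) →
      (∀ z : Fin (B + 1 + 1) → ℝ, (∀ j, 0 < affB B 1 (M₀' j) z) →
        (0 < u.1 (Fin.last B) → affB B 1 ℓ₂ z ≤ affB B 1 ylo' z) ∧ (u.1 (Fin.last B) < 0 → affB B 1 yhi' z ≤ affB B 1 ℓ₂ z)) →
      (∀ z : Fin (B + 1 + 1) → ℝ, (∀ j, 0 < affB B 1 (M₀' j) z) →
        affF B 1 v z - affF B 1 u z < ε * (affB B 1 yhi' z - affB B 1 ylo' z)) →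
      (∃ δ : ℝ, 0 < δ ∧ ∀ z : Fin (B + 1 + 1) → ℝ, (∀ j, 0 < affB B 1 (M₀' j) z) →
        δ ≤ |affB B 1 ylo' z - affB B 1 ℓ₂ z| ∧ δ ≤ |affB B 1 yhi' z - affB B 1 ℓ₂ z|) →
      (∃ z ∈ closure {z : Fin (B + 1 + 1) → ℝ | ∀ j, 0 < affF B 1 (M' j) z},
        affB B 1 ylo' z = affB B 1 yhi' z ∧ affF B 1 u z = affF B 1 v z ∧
          affB B 1 (restr B u) z + (u.1 (Fin.last B) : ℝ) * affB B 1 ℓ₂ z = 0) →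
      ∃ c ∈ AddSubgroup.closure (GGset B 2 1), KZ.of s' - c ∈ KZ.relations)
    (HQ : ∀ (m'' m₀' : ℕ) (s' : KZ.IntegralRep (B + 1 + 1)) (M' : Fin m'' → (Fin (B + 1) → ℚ) × ℚ)
      (M₀' : Fin m₀' → (Fin B → ℚ) × ℚ) (ylo' yhi' : (Fin B → ℚ) × ℚ), Bornology.IsBounded s'.domain →
      s'.domain = gDom B 1 m'' M' (fun _ => Sum.inr u) (fun _ => Sum.inr v) →
      EqOn s'.integrand (glit B 1 p L e ℓ₁ ℓ₂ 0 1 (fun _ => some 0)) s'.domain →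
      (∀ z : Fin (B + 1 + 1) → ℝ, (∀ j, 0 < affF B 1 (M' j) z) → 0 < affF B 1 u z ∧ affF B 1 u z < affF B 1 v z) →
      (∀ z : Fin (B + 1 + 1) → ℝ, (∀ j, 0 < affF B 1 (M' j) z) ↔ ((∀ j, 0 < affB B 1 (M₀' j) z) ∧
        affB B 1 ylo' z < z (Fin.castAdd 1 (Fin.last B)) ∧ z (Fin.castAdd 1 (Fin.last B)) < affB B 1 yhi' z)) →
      (∀ z : Fin (B + 1 + 1) → ℝ, (∀ j, 0 < affB B 1 (M₀' j) z) → affB B 1 ylo' z < affB B 1 yhi' z) →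
      (∀ z : Fin (B + 1 + 1) → ℝ, (∀ j, 0 < affB B 1 (M₀' j) z) →
        (0 < u.1 (Fin.last B) → affB B 1 ℓ₂ z ≤ affB B 1 ylo' z) ∧ (u.1 (Fin.last B) < 0 → affB B 1 yhi' z ≤ affB B 1 ℓ₂ z)) →
      (∀ z : Fin (B + 1 + 1) → ℝ, (∀ j, 0 < affB B 1 (M₀' j) z) →
        affF B 1 v z - affF B 1 u z < ε * (affB B 1 yhi' z - affB B 1 ylo' z)) →
      (∃ z ∈ closure {z : Fin (B + 1 + 1) → ℝ | ∀ j, 0 < affF B 1 (M' j) z},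
        affB B 1 ylo' z = affB B 1 yhi' z ∧ affF B 1 u z = affF B 1 v z ∧
          affB B 1 (restr B u) z + (u.1 (Fin.last B) : ℝ) * affB B 1 ℓ₂ z = 0 ∧ affB B 1 ylo' z = affB B 1 ℓ₂ z) →
      ∃ c ∈ AddSubgroup.closure (GGset B 2 1), KZ.of s' - c ∈ KZ.relations) :
    ∃ c ∈ AddSubgroup.closure (GGset B 2 1), KZ.of s - c ∈ KZ.relations := by
  set sq : ℚ := u.1 (Fin.last B) with hsq
  have hs0 : 0 < |(sq : ℝ)| := abs_pos.2 (by exact_mod_cast hu)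
  -- the side of the pole
  have hside : (∀ z : Fin (B + 1 + 1) → ℝ, (∀ j, 0 < affB B 1 (M₀ j) z) →
      (0 < sq → affB B 1 ℓ₂ z ≤ affB B 1 ylo z) ∧ (sq < 0 → affB B 1 yhi z ≤ affB B 1 ℓ₂ z)) ∨
      (∀ z : Fin (B + 1 + 1) → ℝ, (∀ j, 0 < affB B 1 (M₀ j) z) →
      (0 < sq → affB B 1 yhi z ≤ affB B 1 ℓ₂ z) ∧ (sq < 0 → affB B 1 ℓ₂ z ≤ affB B 1 ylo z)) := by
    rcases pole_one_side M₀ ylo yhi ℓ₂ hne hpole with hbelow | habove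
    · rcases lt_or_gt_of_ne hu with hn | hp
      · exact Or.inr fun z hz => ⟨fun h => absurd hn (not_lt.2 h.le), fun _ => hbelow z hz⟩
      · exact Or.inl fun z hz => ⟨fun _ => hbelow z hz, fun h => absurd hp (not_lt.2 h.le)⟩
    · rcases lt_or_gt_of_ne hu with hn | hp
      · exact Or.inl fun z hz => ⟨fun h => absurd hn (not_lt.2 h.le), fun _ => habove z hz⟩
      · exact Or.inr fun z hz => ⟨fun _ => habove z hz, fun h => absurd hp (not_lt.2 h.le)⟩
  rcases hside with hfar | hnear
  swap
  · exact good_parCell_nearSide L e ℓ₁ ℓ₂ s M M₀ ylo yhi p u v hbd hdom hint hu hpar hcell hsec hne hnear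
  -- the far side: cut at `w = ε h`
  set hF : (Fin B → ℚ) × ℚ := yhi - ylo with hhF
  set wF : (Fin B → ℚ) × ℚ := restr B v - restr B u with hwF
  have hhz : ∀ z : Fin (B + 1 + 1) → ℝ, affB B 1 hF z = affB B 1 yhi z - affB B 1 ylo z :=
    fun z => by rw [hhF, affB_sub]
  have hwz : ∀ z : Fin (B + 1 + 1) → ℝ, affB B 1 wF z = affF B 1 v z - affF B 1 u z :=
    fun z => by rw [hwF, affB_sub, width_eq u v hpar]
  set g : (Fin B → ℚ) × ℚ := ε • hF - wF with hg
  have hgz : ∀ z : Fin (B + 1 + 1) → ℝ, affB B 1 g z =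
      (ε : ℝ) * (affB B 1 yhi z - affB B 1 ylo z) - (affF B 1 v z - affF B 1 u z) := fun z => by
    rw [hg, affB_sub, affB_smul', hhz, hwz]
  -- the number of level splits where `ε h ≤ w`
  set N : ℕ := ⌈|(sq : ℝ)| / ε⌉₊ with hN
  have hε' : (0 : ℝ) < ε := by exact_mod_cast hε
  have hNr : |(sq : ℝ)| ≤ (N : ℝ) * ε := by
    have h := Nat.le_ceil (|(sq : ℝ)| / ε)
    rw [← hN, div_le_iff₀ hε'] at h
    exact h
  have hlev : ∀ z : Fin (B + 1 + 1) → ℝ, (∀ j, 0 < affB B 1 (M₀ j) z) →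
      (ε : ℝ) * (affB B 1 yhi z - affB B 1 ylo z) ≤ affF B 1 v z - affF B 1 u z →
      |(u.1 (Fin.last B) : ℝ)| * (affB B 1 yhi z - affB B 1 ylo z) ≤ ((N : ℝ) + 1) * (affF B 1 v z - affF B 1 u z) := by
    intro z hz hle
    have hh : 0 < affB B 1 yhi z - affB B 1 ylo z := by linarith [hne z hz]
    have hw : 0 ≤ affF B 1 v z - affF B 1 u z := by nlinarith
    rw [← hsq]
    calc |(sq : ℝ)| * (affB B 1 yhi z - affB B 1 ylo z) ≤ (N : ℝ) * ε * (affB B 1 yhi z - affB B 1 ylo z) :=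
          mul_le_mul_of_nonneg_right hNr hh.le
      _ = (N : ℝ) * ((ε : ℝ) * (affB B 1 yhi z - affB B 1 ylo z)) := by ring
      _ ≤ (N : ℝ) * (affF B 1 v z - affF B 1 u z) := mul_le_mul_of_nonneg_left hle (Nat.cast_nonneg N)
      _ ≤ ((N : ℝ) + 1) * (affF B 1 v z - affF B 1 u z) := by nlinarith
  by_cases hg0 : g = 0
  · -- `w = ε h` identically: level splits on the whole cell
    refine good_parLevel L e ℓ₁ ℓ₂ 0 1 M₀ yhi p u v (Or.inl rfl) hpar N s M ylo hbd hdom hint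
      (fun z hz => (hsec z).1 hz) fun z hz => ?_
    obtain ⟨h0, -, -⟩ := (hsec z).1 hz
    have h := hgz z
    rw [hg0, affB_zeroYT] at h
    exact hlev z h0 (by linarith)
  obtain ⟨s₁, s₂, hsub₁, hsub₂, hi₁, hi₂, hd₁, hd₂, hsec₁, hsec₂, hrel⟩ :=
    cutCell s M M₀ ylo yhi u v hdom hsec g hg0
  refine good_of_split hrel ?_ ?_
  · -- `w < ε h`: thin far-side cell
    refine good_parCell_far_thin L e ℓ₁ ℓ₂ ε s₁ _ (Fin.snoc M₀ g) ylo yhi p u v (hbd.subset hsub₁) hd₁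
      (by rw [hi₁]; exact hint.mono hsub₁) hu hpar (fun z hz => hcell z (rows_snoc hz).1) hsec₁
      (fun z hz => hne z (rowsB_snoc_iff.1 hz).1) (fun z hz => hpole z (rowsB_snoc_iff.1 hz).1)
      (fun z hz => hfar z (rowsB_snoc_iff.1 hz).1) (fun z hz => ?_) HU HQ
    obtain ⟨-, h1⟩ := rowsB_snoc_iff.1 hz
    rw [hgz] at h1
    linarith
  · -- `ε h < w`: level splits
    refine good_parLevel L e ℓ₁ ℓ₂ 0 1 (Fin.snoc M₀ (-g)) yhi p u v (Or.inl rfl) hpar N s₂ _ ylo (hbd.subset hsub₂)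
      hd₂ (by rw [hi₂]; exact hint.mono hsub₂) (fun z hz => (hsec₂ z).1 hz) fun z hz => ?_
    obtain ⟨h0, -, -⟩ := (hsec₂ z).1 hz
    obtain ⟨h00, h1⟩ := rowsB_snoc_iff.1 h0
    rw [affB_neg', hgz] at h1
    exact hlev z h00 (by linarith)


/-- **A product cell from `HU` and `HQ`, no side hypotheses** (cf. `good_parCell_of_noTriple'`):
a degenerate `x'`-factor gives a zero integrand, `pole_outside` puts the pole outside the
`y`-range, and one cut along `yhi − ylo = 0` (rule 1a; the other piece is empty) makes the
range non-degenerate on the `x'`-cell. -/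
theorem good_parCell_of_thinQuad' (ε : ℚ) (hε : 0 < ε) (s : KZ.IntegralRep (B + 1 + 1)) (M : Fin m' → (Fin (B + 1) → ℚ) × ℚ)
    (M₀ : Fin m₀ → (Fin B → ℚ) × ℚ) (ylo yhi : (Fin B → ℚ) × ℚ) (p : MvPolynomial (Fin B) ℚ)
    (u v : (Fin (B + 1) → ℚ) × ℚ) (hbd : Bornology.IsBounded s.domain)
    (hdom : s.domain = gDom B 1 m' M (fun _ => Sum.inr u) (fun _ => Sum.inr v))
    (hint : EqOn s.integrand (glit B 1 p L e ℓ₁ ℓ₂ 0 1 (fun _ => some 0)) s.domain)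
    (hu : u.1 (Fin.last B) ≠ 0) (hpar : u.1 (Fin.last B) = v.1 (Fin.last B))
    (hcell : ∀ z : Fin (B + 1 + 1) → ℝ, (∀ j, 0 < affF B 1 (M j) z) → 0 < affF B 1 u z ∧ affF B 1 u z < affF B 1 v z)
    (hsec : ∀ z : Fin (B + 1 + 1) → ℝ, (∀ j, 0 < affF B 1 (M j) z) ↔ ((∀ j, 0 < affB B 1 (M₀ j) z) ∧
      affB B 1 ylo z < z (Fin.castAdd 1 (Fin.last B)) ∧ z (Fin.castAdd 1 (Fin.last B)) < affB B 1 yhi z))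
    (HU : ∀ (m'' m₀' : ℕ) (s' : KZ.IntegralRep (B + 1 + 1)) (M' : Fin m'' → (Fin (B + 1) → ℚ) × ℚ)
      (M₀' : Fin m₀' → (Fin B → ℚ) × ℚ) (ylo' yhi' : (Fin B → ℚ) × ℚ), Bornology.IsBounded s'.domain →
      s'.domain = gDom B 1 m'' M' (fun _ => Sum.inr u) (fun _ => Sum.inr v) →
      EqOn s'.integrand (glit B 1 p L e ℓ₁ ℓ₂ 0 1 (fun _ => some 0)) s'.domain →
      (∀ z : Fin (B + 1 + 1) → ℝ, (∀ j, 0 < affF B 1 (M' j) z) → 0 < affF B 1 u z ∧ affF B 1 u z < affF B 1 v z) →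
      (∀ z : Fin (B + 1 + 1) → ℝ, (∀ j, 0 < affF B 1 (M' j) z) ↔ ((∀ j, 0 < affB B 1 (M₀' j) z) ∧
        affB B 1 ylo' z < z (Fin.castAdd 1 (Fin.last B)) ∧ z (Fin.castAdd 1 (Fin.last B)) < affB B 1 yhi' z)) →
      (∀ z : Fin (B + 1 + 1) → ℝ, (∀ j, 0 < affB B 1 (M₀' j) z) → affB B 1 ylo' z < affB B 1 yhi' z) →
      (∀ z : Fin (B + 1 + 1) → ℝ, (∀ j, 0 < affB B 1 (M₀' j) z) →
        (0 < u.1 (Fin.last B) → affB B 1 ℓ₂ z ≤ affB B 1 ylo' z) ∧ (u.1 (Fin.last B) < 0 → affB B 1 yhi' z ≤ affB B 1 ℓ₂ z)) →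
      (∀ z : Fin (B + 1 + 1) → ℝ, (∀ j, 0 < affB B 1 (M₀' j) z) →
        affF B 1 v z - affF B 1 u z < ε * (affB B 1 yhi' z - affB B 1 ylo' z)) →
      (∃ δ : ℝ, 0 < δ ∧ ∀ z : Fin (B + 1 + 1) → ℝ, (∀ j, 0 < affB B 1 (M₀' j) z) →
        δ ≤ |affB B 1 ylo' z - affB B 1 ℓ₂ z| ∧ δ ≤ |affB B 1 yhi' z - affB B 1 ℓ₂ z|) →
      (∃ z ∈ closure {z : Fin (B + 1 + 1) → ℝ | ∀ j, 0 < affF B 1 (M' j) z},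
        affB B 1 ylo' z = affB B 1 yhi' z ∧ affF B 1 u z = affF B 1 v z ∧
          affB B 1 (restr B u) z + (u.1 (Fin.last B) : ℝ) * affB B 1 ℓ₂ z = 0) →
      ∃ c ∈ AddSubgroup.closure (GGset B 2 1), KZ.of s' - c ∈ KZ.relations)
    (HQ : ∀ (m'' m₀' : ℕ) (s' : KZ.IntegralRep (B + 1 + 1)) (M' : Fin m'' → (Fin (B + 1) → ℚ) × ℚ)
      (M₀' : Fin m₀' → (Fin B → ℚ) × ℚ) (ylo' yhi' : (Fin B → ℚ) × ℚ), Bornology.IsBounded s'.domain →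
      s'.domain = gDom B 1 m'' M' (fun _ => Sum.inr u) (fun _ => Sum.inr v) →
      EqOn s'.integrand (glit B 1 p L e ℓ₁ ℓ₂ 0 1 (fun _ => some 0)) s'.domain →
      (∀ z : Fin (B + 1 + 1) → ℝ, (∀ j, 0 < affF B 1 (M' j) z) → 0 < affF B 1 u z ∧ affF B 1 u z < affF B 1 v z) →
      (∀ z : Fin (B + 1 + 1) → ℝ, (∀ j, 0 < affF B 1 (M' j) z) ↔ ((∀ j, 0 < affB B 1 (M₀' j) z) ∧
        affB B 1 ylo' z < z (Fin.castAdd 1 (Fin.last B)) ∧ z (Fin.castAdd 1 (Fin.last B)) < affB B 1 yhi' z)) →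
      (∀ z : Fin (B + 1 + 1) → ℝ, (∀ j, 0 < affB B 1 (M₀' j) z) → affB B 1 ylo' z < affB B 1 yhi' z) →
      (∀ z : Fin (B + 1 + 1) → ℝ, (∀ j, 0 < affB B 1 (M₀' j) z) →
        (0 < u.1 (Fin.last B) → affB B 1 ℓ₂ z ≤ affB B 1 ylo' z) ∧ (u.1 (Fin.last B) < 0 → affB B 1 yhi' z ≤ affB B 1 ℓ₂ z)) →
      (∀ z : Fin (B + 1 + 1) → ℝ, (∀ j, 0 < affB B 1 (M₀' j) z) →
        affF B 1 v z - affF B 1 u z < ε * (affB B 1 yhi' z - affB B 1 ylo' z)) →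
      (∃ z ∈ closure {z : Fin (B + 1 + 1) → ℝ | ∀ j, 0 < affF B 1 (M' j) z},
        affB B 1 ylo' z = affB B 1 yhi' z ∧ affF B 1 u z = affF B 1 v z ∧
          affB B 1 (restr B u) z + (u.1 (Fin.last B) : ℝ) * affB B 1 ℓ₂ z = 0 ∧ affB B 1 ylo' z = affB B 1 ℓ₂ z) →
      ∃ c ∈ AddSubgroup.closure (GGset B 2 1), KZ.of s' - c ∈ KZ.relations) :
    ∃ c ∈ AddSubgroup.closure (GGset B 2 1), KZ.of s - c ∈ KZ.relations := by
  by_cases hdeg : p = 0 ∨ ∃ j, e j ≠ 0 ∧ L j = 0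
  · -- the integrand vanishes on the domain
    refine ⟨0, zero_mem _, ?_⟩
    rw [sub_zero]
    refine KZ.of_mem_relations_of_eqOn_zero s fun z hz => ?_
    rw [hint hz, Pi.zero_apply, glit_one]
    rcases hdeg with hp | ⟨j, hej, hLj⟩
    · rw [hp, map_zero, zero_div, zero_mul, zero_mul]
    · have h0 : ∏ j, (affB B 1 (L j) z) ^ e j = 0 := by
        refine Finset.prod_eq_zero (Finset.mem_univ j) ?_
        rw [hLj]
        simp [affB, hej]
      rw [h0, div_zero, zero_mul, zero_mul]
  push Not at hdeg
  obtain ⟨hp, hL⟩ := hdeg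
  -- the height `h = yhi − ylo` as an extra `x'`-row
  set hF : (Fin B → ℚ) × ℚ := yhi - ylo with hhF
  have hhz : ∀ z : Fin (B + 1 + 1) → ℝ, affB B 1 hF z = affB B 1 yhi z - affB B 1 ylo z :=
    fun z => by rw [hhF, affB_sub]
  by_cases hF0 : hF = 0
  · refine good_of_null s ?_
    rw [hdom]
    refine measure_mono_null (fun z hz => ?_) measure_empty
    obtain ⟨-, hlo, hhi⟩ := (hsec z).1 ((mem_gDom_one M u v z).1 hz).1
    have h := hhz z
    rw [hF0, affB_zeroYT] at h
    exact absurd h (by linarith)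
  obtain ⟨s₁, s₂, hsub₁, hsub₂, hi₁, hi₂, hd₁, hd₂, hsec₁, hsec₂, hrel⟩ :=
    cutCell s M M₀ ylo yhi u v hdom hsec hF hF0
  refine good_of_split hrel ?_ ?_
  · -- `yhi > ylo` on the `x'`-cell; the pole is outside the `y`-range by `pole_outside`
    have hint₁ : EqOn s₁.integrand (glit B 1 p L e ℓ₁ ℓ₂ 0 1 (fun _ => some 0)) s₁.domain := by
      rw [hi₁]; exact hint.mono hsub₁
    have hcell₁ : ∀ z : Fin (B + 1 + 1) → ℝ, (∀ j, 0 < affF B 1 ((Fin.snoc M (liftX hF) : Fin (m' + 1) → _) j) z) →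
        0 < affF B 1 u z ∧ affF B 1 u z < affF B 1 v z := fun z hz => hcell z (rows_snoc hz).1
    refine good_parCell_of_thinQuad L e ℓ₁ ℓ₂ ε hε s₁ _ (Fin.snoc M₀ hF) ylo yhi p u v (hbd.subset hsub₁) hd₁ hint₁
      hu hpar hcell₁ hsec₁ (fun z hz => ?_)
      (pole_outside L e ℓ₁ ℓ₂ s₁ _ (Fin.snoc M₀ hF) ylo yhi p u v hd₁ hint₁ hpar hcell₁ hsec₁ hp hL) HU HQ
    have h := (rowsB_snoc_iff.1 hz).2
    rw [hhz] at h
    linarith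
  · -- `yhi < ylo`: empty
    refine good_of_null s₂ ?_
    rw [hd₂]
    refine measure_mono_null (fun z hz => ?_) measure_empty
    obtain ⟨h0, hlo, hhi⟩ := (hsec₂ z).1 ((mem_gDom_one _ u v z).1 hz).1
    have h := (rowsB_snoc_iff.1 h0).2
    rw [affB_neg', hhz] at h
    linarith

/-- **The residual hypothesis `Hpar` from `HU` and `HQ`** (any base dimension, any rational
`ε > 0`): over any bounded base cell, via `par_cells` and `good_parCell_of_thinQuad'`. -/
theorem good_par_of_thinQuad (ε : ℚ) (hε : 0 < ε) (s : KZ.IntegralRep (B + 1 + 1)) (M : Fin m' → (Fin (B + 1) → ℚ) × ℚ)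
    (p : MvPolynomial (Fin B) ℚ) (u v : (Fin (B + 1) → ℚ) × ℚ) (hbd : Bornology.IsBounded s.domain)
    (hdom : s.domain = gDom B 1 m' M (fun _ => Sum.inr u) (fun _ => Sum.inr v))
    (hint : EqOn s.integrand (glit B 1 p L e ℓ₁ ℓ₂ 0 1 (fun _ => some 0)) s.domain)
    (hu : u.1 (Fin.last B) ≠ 0) (hpar : u.1 (Fin.last B) = v.1 (Fin.last B))
    (hcell : ∀ z : Fin (B + 1 + 1) → ℝ, (∀ j, 0 < affF B 1 (M j) z) →
      0 < affF B 1 u z ∧ affF B 1 u z < affF B 1 v z)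
    (HU : ∀ (m'' m₀' : ℕ) (s' : KZ.IntegralRep (B + 1 + 1)) (M' : Fin m'' → (Fin (B + 1) → ℚ) × ℚ)
      (M₀' : Fin m₀' → (Fin B → ℚ) × ℚ) (ylo' yhi' : (Fin B → ℚ) × ℚ), Bornology.IsBounded s'.domain →
      s'.domain = gDom B 1 m'' M' (fun _ => Sum.inr u) (fun _ => Sum.inr v) →
      EqOn s'.integrand (glit B 1 p L e ℓ₁ ℓ₂ 0 1 (fun _ => some 0)) s'.domain →
      (∀ z : Fin (B + 1 + 1) → ℝ, (∀ j, 0 < affF B 1 (M' j) z) → 0 < affF B 1 u z ∧ affF B 1 u z < affF B 1 v z) →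
      (∀ z : Fin (B + 1 + 1) → ℝ, (∀ j, 0 < affF B 1 (M' j) z) ↔ ((∀ j, 0 < affB B 1 (M₀' j) z) ∧
        affB B 1 ylo' z < z (Fin.castAdd 1 (Fin.last B)) ∧ z (Fin.castAdd 1 (Fin.last B)) < affB B 1 yhi' z)) →
      (∀ z : Fin (B + 1 + 1) → ℝ, (∀ j, 0 < affB B 1 (M₀' j) z) → affB B 1 ylo' z < affB B 1 yhi' z) →
      (∀ z : Fin (B + 1 + 1) → ℝ, (∀ j, 0 < affB B 1 (M₀' j) z) →
        (0 < u.1 (Fin.last B) → affB B 1 ℓ₂ z ≤ affB B 1 ylo' z) ∧ (u.1 (Fin.last B) < 0 → affB B 1 yhi' z ≤ affB B 1 ℓ₂ z)) →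
      (∀ z : Fin (B + 1 + 1) → ℝ, (∀ j, 0 < affB B 1 (M₀' j) z) →
        affF B 1 v z - affF B 1 u z < ε * (affB B 1 yhi' z - affB B 1 ylo' z)) →
      (∃ δ : ℝ, 0 < δ ∧ ∀ z : Fin (B + 1 + 1) → ℝ, (∀ j, 0 < affB B 1 (M₀' j) z) →
        δ ≤ |affB B 1 ylo' z - affB B 1 ℓ₂ z| ∧ δ ≤ |affB B 1 yhi' z - affB B 1 ℓ₂ z|) →
      (∃ z ∈ closure {z : Fin (B + 1 + 1) → ℝ | ∀ j, 0 < affF B 1 (M' j) z},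
        affB B 1 ylo' z = affB B 1 yhi' z ∧ affF B 1 u z = affF B 1 v z ∧
          affB B 1 (restr B u) z + (u.1 (Fin.last B) : ℝ) * affB B 1 ℓ₂ z = 0) →
      ∃ c ∈ AddSubgroup.closure (GGset B 2 1), KZ.of s' - c ∈ KZ.relations)
    (HQ : ∀ (m'' m₀' : ℕ) (s' : KZ.IntegralRep (B + 1 + 1)) (M' : Fin m'' → (Fin (B + 1) → ℚ) × ℚ)
      (M₀' : Fin m₀' → (Fin B → ℚ) × ℚ) (ylo' yhi' : (Fin B → ℚ) × ℚ), Bornology.IsBounded s'.domain →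
      s'.domain = gDom B 1 m'' M' (fun _ => Sum.inr u) (fun _ => Sum.inr v) →
      EqOn s'.integrand (glit B 1 p L e ℓ₁ ℓ₂ 0 1 (fun _ => some 0)) s'.domain →
      (∀ z : Fin (B + 1 + 1) → ℝ, (∀ j, 0 < affF B 1 (M' j) z) → 0 < affF B 1 u z ∧ affF B 1 u z < affF B 1 v z) →
      (∀ z : Fin (B + 1 + 1) → ℝ, (∀ j, 0 < affF B 1 (M' j) z) ↔ ((∀ j, 0 < affB B 1 (M₀' j) z) ∧
        affB B 1 ylo' z < z (Fin.castAdd 1 (Fin.last B)) ∧ z (Fin.castAdd 1 (Fin.last B)) < affB B 1 yhi' z)) →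
      (∀ z : Fin (B + 1 + 1) → ℝ, (∀ j, 0 < affB B 1 (M₀' j) z) → affB B 1 ylo' z < affB B 1 yhi' z) →
      (∀ z : Fin (B + 1 + 1) → ℝ, (∀ j, 0 < affB B 1 (M₀' j) z) →
        (0 < u.1 (Fin.last B) → affB B 1 ℓ₂ z ≤ affB B 1 ylo' z) ∧ (u.1 (Fin.last B) < 0 → affB B 1 yhi' z ≤ affB B 1 ℓ₂ z)) →
      (∀ z : Fin (B + 1 + 1) → ℝ, (∀ j, 0 < affB B 1 (M₀' j) z) →
        affF B 1 v z - affF B 1 u z < ε * (affB B 1 yhi' z - affB B 1 ylo' z)) →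
      (∃ z ∈ closure {z : Fin (B + 1 + 1) → ℝ | ∀ j, 0 < affF B 1 (M' j) z},
        affB B 1 ylo' z = affB B 1 yhi' z ∧ affF B 1 u z = affF B 1 v z ∧
          affB B 1 (restr B u) z + (u.1 (Fin.last B) : ℝ) * affB B 1 ℓ₂ z = 0 ∧ affB B 1 ylo' z = affB B 1 ℓ₂ z) →
      ∃ c ∈ AddSubgroup.closure (GGset B 2 1), KZ.of s' - c ∈ KZ.relations) :
    ∃ c ∈ AddSubgroup.closure (GGset B 2 1), KZ.of s - c ∈ KZ.relations :=
  par_cells s M u v hbd hdom fun m'' m₀ s' M' M₀ ylo yhi hsub hi' hd' hsec hbase =>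
    good_parCell_of_thinQuad' L e ℓ₁ ℓ₂ ε hε s' M' M₀ ylo yhi p u v (hbd.subset hsub) hd'
      (by rw [hi']; exact hint.mono hsub) hu hpar (fun z hz => hcell z (hbase z hz)) hsec HU HQ

end ThinQuadCell

end RebasePos

/-- **Registered part of `stub_rebaseSimplePosOnePos` (line `janus-bands`): the residual
hypothesis `Hpar` of the one-fibre rebase from THIN FAR-SIDE cells away from the pole or with
a QUADRUPLE point, any base dimension, any rational `ε > 0`.** The data of `Hpar` (one lettered
fibre over a bounded base cell in `ℝ^{B+1}`, letter `0`, affine bounds `0 < u < v` parallel in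
`y` with common slope `s = u_y ≠ 0`, base factor `p(x')/∏ Lⱼ(x')^{eⱼ} · 1/(y − ℓ₂(x'))`):
`[s] ∈ closure (GG B 2 1)` modulo `KZ.relations` AS SOON AS (`HUQ`) this holds for the
restrictions to product cells `{x'-rows M₀} × (ylo(x'), yhi(x'))` (`hsec`) with non-degenerate
`y`-range, the pole on the FAR side (`ℓ₂ ≤ ylo` if `s > 0`, `yhi ≤ ℓ₂` if `s < 0`), THIN
(`v − u < ε (yhi − ylo)` on the `x'`-cell), and EITHER at distance `≥ δ > 0` from the pole with
a triple point `ylo = yhi`, `u = v`, `u₀ + s ℓ₂ = 0` on the closed cell OR with a quadruple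
point (additionally `ylo = ℓ₂`) on the closed cell. Everything else: parts `ParTriple*`,
`good_parCell_nearSide`, level splits, and the extreme value theorem for `max (h, w, |κ'|, a)`
(`RebasePos.good_par_of_thinQuad`). -/
theorem rebaseSimplePos_par_of_thinQuad (B m m' : ℕ) (ε : ℚ) (hε : 0 < ε) (s : KZ.IntegralRep (B + 1 + 1)) (M : Fin m' → (Fin (B + 1) → ℚ) × ℚ) (L : Fin m → (Fin B → ℚ) × ℚ) (e : Fin m → ℕ) (p : MvPolynomial (Fin B) ℚ) (ℓ₁ ℓ₂ : (Fin B → ℚ) × ℚ) (u v : (Fin (B + 1) → ℚ) × ℚ) (hbd : Bornology.IsBounded s.domain) (hdom : s.domain = SeparatePos.gDom B 1 m' M (fun _ => Sum.inr u) (fun _ => Sum.inr v)) (hint : Set.EqOn s.integrand (RebasePos.glit B 1 p L e ℓ₁ ℓ₂ 0 1 (fun _ => some 0)) s.domain) (hu : u.1 (Fin.last B) ≠ 0) (hpar : u.1 (Fin.last B) = v.1 (Fin.last B)) (hcell : ∀ z : Fin (B + 1 + 1) → ℝ, (∀ j, 0 < SeparatePos.affF B 1 (M j) z) → 0 < SeparatePos.affF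 B 1 u z ∧ SeparatePos.affF B 1 u z < SeparatePos.affF B 1 v z) (HUQ : ∀ (m'' m₀' : ℕ) (s' : KZ.IntegralRep (B + 1 + 1)) (M' : Fin m'' → (Fin (B + 1) → ℚ) × ℚ) (M₀' : Fin m₀' → (Fin B → ℚ) × ℚ) (ylo' yhi' : (Fin B → ℚ) × ℚ), Bornology.IsBounded s'.domain → s'.domain = SeparatePos.gDom B 1 m'' M' (fun _ => Sum.inr u) (fun _ => Sum.inr v) → EqOn s'.integrand (RebasePos.glit B 1 p L e ℓ₁ ℓ₂ 0 1 (fun _ => some 0)) s'.domain → (∀ z : Fin (B + 1 + 1) → ℝ, (∀ j, 0 < SeparatePos.affF B 1 (M' j) z) → 0 < SeparatePos.affF B 1 u z ∧ SeparatePos.affF B 1 u z < SeparatePos.affF B 1 v z) → (∀ z : Fin (B + 1 + 1) → ℝ, (∀ j, 0 < SeparatePos.affF B 1 (M' j) z) ↔ ((∀ j, 0 < SeparatePos.affB B 1 (M₀' j) z) ∧ SeparatePos.affB B 1 ylo' z < z (Fin.castAdd 1 (Fin.last B)) ∧ z (Fin.castAdd 1 (Fin.last B)) < SeparatePos.affB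 B 1 yhi' z)) → (∀ z : Fin (B + 1 + 1) → ℝ, (∀ j, 0 < SeparatePos.affB B 1 (M₀' j) z) → SeparatePos.affB B 1 ylo' z < SeparatePos.affB B 1 yhi' z) → (∀ z : Fin (B + 1 + 1) → ℝ, (∀ j, 0 < SeparatePos.affB B 1 (M₀' j) z) → (0 < u.1 (Fin.last B) → SeparatePos.affB B 1 ℓ₂ z ≤ SeparatePos.affB B 1 ylo' z) ∧ (u.1 (Fin.last B) < 0 → SeparatePos.affB B 1 yhi' z ≤ SeparatePos.affB B 1 ℓ₂ z)) → (∀ z : Fin (B + 1 + 1) → ℝ, (∀ j, 0 < SeparatePos.affB B 1 (M₀' j) z) → SeparatePos.affF B 1 v z - SeparatePos.affF B 1 u z < ε * (SeparatePos.affB B 1 yhi' z - SeparatePos.affB B 1 ylo' z)) → ((∃ δ : ℝ, 0 < δ ∧ ∀ z : Fin (B + 1 + 1) → ℝ, (∀ j, 0 < SeparatePos.affB B 1 (M₀' j) z) → δ ≤ |SeparatePos.affB B 1 ylo' z - SeparatePos.affB B 1 ℓ₂ z| ∧ δ ≤ |SeparatePos.affB B 1 yhi' z - SeparatePos.affB B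 1 ℓ₂ z|) ∧ (∃ z ∈ closure {z : Fin (B + 1 + 1) → ℝ | ∀ j, 0 < SeparatePos.affF B 1 (M' j) z}, SeparatePos.affB B 1 ylo' z = SeparatePos.affB B 1 yhi' z ∧ SeparatePos.affF B 1 u z = SeparatePos.affF B 1 v z ∧ SeparatePos.affB B 1 (SeparatePos.restr B u) z + (u.1 (Fin.last B) : ℝ) * SeparatePos.affB B 1 ℓ₂ z = 0)) ∨ (∃ z ∈ closure {z : Fin (B + 1 + 1) → ℝ | ∀ j, 0 < SeparatePos.affF B 1 (M' j) z}, SeparatePos.affB B 1 ylo' z = SeparatePos.affB B 1 yhi' z ∧ SeparatePos.affF B 1 u z = SeparatePos.affF B 1 v z ∧ SeparatePos.affB B 1 (SeparatePos.restr B u) z + (u.1 (Fin.last B) : ℝ) * SeparatePos.affB B 1 ℓ₂ z = 0 ∧ SeparatePos.affB B 1 ylo' z = SeparatePos.affB B 1 ℓ₂ z) → ∃ c ∈ AddSubgroup.closure (SeparatePos.GGset B 2 1), KZ.of s' - c ∈ KZ.relations) : ∃ c ∈ AddSubgroup.closure (SeparatePos.GGset B 2 1), KZ.of s - c ∈ KZ.relations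 :=
  RebasePos.good_par_of_thinQuad L e ℓ₁ ℓ₂ ε hε s M p u v hbd hdom hint hu hpar hcell
    (fun m'' m₀' s' M' M₀' ylo' yhi' hbd' hdom' hint' hcell' hsec' hne' hfar' hthin' hδ htr =>
      HUQ m'' m₀' s' M' M₀' ylo' yhi' hbd' hdom' hint' hcell' hsec' hne' hfar' hthin' (Or.inl ⟨hδ, htr⟩))
    (fun m'' m₀' s' M' M₀' ylo' yhi' hbd' hdom' hint' hcell' hsec' hne' hfar' hthin' hq =>
      HUQ m'' m₀' s' M' M₀' ylo' yhi' hbd' hdom' hint' hcell' hsec' hne' hfar' hthin' (Or.inr hq))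

/-- **The stub `stub_rebaseSimplePosOnePos` reduced to thin far-side triple cells and double
corners** (exactly its signature plus `ε`, `HUQ`, `Hdthick`, `Hdfar` at `B = b + 2`; see the
module docstring): `GS (b+2) 1 → closure (GG (b+2) 2 1 ∪ JJ (b+2) 2 ∪ JD (b+3))` modulo
`KZ.relations`. -/
theorem rebaseSimplePosOnePos_of_thinQuad' (GS : ℕ → ℕ → Set KZ.FormalRep) (GG : ℕ → ℕ → ℕ → Set KZ.FormalRep) (hGS : ∀ b k, GS b k = {w : KZ.FormalRep | ∃ (m m' n₁ n₂ : ℕ) (s : KZ.IntegralRep (b + 1 + k)) (M : Fin m' → (Fin (b + 1) → ℚ) × ℚ) (L : Fin m → (Fin b → ℚ) × ℚ) (e : Fin m → ℕ) (p : MvPolynomial (Fin b) ℚ) (ℓ₁ ℓ₂ : (Fin b → ℚ) × ℚ) (a : Fin k → Option ((Fin (b + 1) → ℚ) × ℚ)) (lo hi : Fin k → Fin k ⊕ ((Fin (b + 1) → ℚ) × ℚ)), (n₁ = 0 ∨ n₂ = 0) ∧ n₂ = 1 ∧ Bornology.IsBounded s.domain ∧ s.domain = {z | (∀ j, 0 <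 ∑ i, ((M j).1 i : ℝ) * z (Fin.castAdd k i) + ((M j).2 : ℝ)) ∧ ∀ i, Sum.elim (fun j => z (Fin.natAdd (b + 1) j)) (fun c => ∑ i', (c.1 i' : ℝ) * z (Fin.castAdd k i') + (c.2 : ℝ)) (lo i) < z (Fin.natAdd (b + 1) i) ∧ z (Fin.natAdd (b + 1) i) < Sum.elim (fun j => z (Fin.natAdd (b + 1) j)) (fun c => ∑ i', (c.1 i' : ℝ) * z (Fin.castAdd k i') + (c.2 : ℝ)) (hi i)} ∧ EqOn s.integrand (fun z => MvPolynomial.aeval (fun i => z (Fin.castAdd k (Fin.castSucc i))) p / (∏ j, (∑ i, ((L j).1 i : ℝ) * z (Fin.castAdd k (Fin.castSucc i)) + ((L j).2 : ℝ)) ^ e j) * ((z (Fin.castAdd k (Fin.last b)) - (∑ i, (ℓ₁.1 i : ℝ) * z (Fin.castAdd k (Fin.castSucc i)) + (ℓ₁.2 : ℝ))) ^ n₁ / (z (Fin.castAdd k (Fin.last b)) - (∑ i, (ℓ₂.1 i : ℝ) * z (Fin.castAdd k (Fin.castSucc i)) + (ℓ₂.2 : ℝ))) ^ n₂) * ∏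 i, (a i).elim 1 (fun c => 1 / (z (Fin.natAdd (b + 1) i) - (∑ i', (c.1 i' : ℝ) * z (Fin.castAdd k i') + (c.2 : ℝ))))) s.domain ∧ w = KZ.of s}) (hGG : ∀ b σ k, GG b σ k = {w : KZ.FormalRep | ∃ (m m' n₁ n₂ : ℕ) (s : KZ.IntegralRep (b + 1 + k)) (M : Fin m' → (Fin (b + 1) → ℚ) × ℚ) (L : Fin m → (Fin b → ℚ) × ℚ) (e : Fin m → ℕ) (p : MvPolynomial (Fin b) ℚ) (ℓ₁ ℓ₂ : (Fin b → ℚ) × ℚ) (a : Fin k → Option ((Fin (b + 1) → ℚ) × ℚ)) (lo hi : Fin k → Fin k ⊕ ((Fin (b + 1) → ℚ) × ℚ)), (n₁ = 0 ∨ n₂ = 0) ∧ (σ = 2 → (∀ i c, a i = some c → c.1 (Fin.last b) = 0) ∧ (∀ i c, (lo i = Sum.inr c ∨ hi i = Sum.inr c) → (c.1 (Fin.last b) = 0 ∨ c = (Pi.single (Fin.last b) 1, 0)))) ∧ Bornology.IsBounded s.domain ∧ s.domain = {z | (∀ j, 0 < ∑ i, ((M j).1 i : ℝ) * z (Fin.castAdd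 k i) + ((M j).2 : ℝ)) ∧ ∀ i, Sum.elim (fun j => z (Fin.natAdd (b + 1) j)) (fun c => ∑ i', (c.1 i' : ℝ) * z (Fin.castAdd k i') + (c.2 : ℝ)) (lo i) < z (Fin.natAdd (b + 1) i) ∧ z (Fin.natAdd (b + 1) i) < Sum.elim (fun j => z (Fin.natAdd (b + 1) j)) (fun c => ∑ i', (c.1 i' : ℝ) * z (Fin.castAdd k i') + (c.2 : ℝ)) (hi i)} ∧ EqOn s.integrand (fun z => MvPolynomial.aeval (fun i => z (Fin.castAdd k (Fin.castSucc i))) p / (∏ j, (∑ i, ((L j).1 i : ℝ) * z (Fin.castAdd k (Fin.castSucc i)) + ((L j).2 : ℝ)) ^ e j) * ((z (Fin.castAdd k (Fin.last b)) - (∑ i, (ℓ₁.1 i : ℝ) * z (Fin.castAdd k (Fin.castSucc i)) + (ℓ₁.2 : ℝ))) ^ n₁ / (z (Fin.castAdd k (Fin.last b)) - (∑ i, (ℓ₂.1 i : ℝ) * z (Fin.castAdd k (Fin.castSucc i)) + (ℓ₂.2 : ℝ))) ^ n₂) * ∏ i, (a i).elim 1 (fun c => 1 / (z (Fin.natAdd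 (b + 1) i) - (∑ i', (c.1 i' : ℝ) * z (Fin.castAdd k i') + (c.2 : ℝ))))) s.domain ∧ w = KZ.of s}) (JJ : ℕ → ℕ → Set KZ.FormalRep) (JD : ℕ → Set KZ.FormalRep) (hJJ : ∀ b k, JJ b k = {w : KZ.FormalRep | ∃ (m m' : ℕ) (s : KZ.IntegralRep (b + k)) (M : Fin m' → (Fin b → ℚ) × ℚ) (L : Fin m → (Fin b → ℚ) × ℚ) (e : Fin m → ℕ) (p : MvPolynomial (Fin b) ℚ) (a : Fin k → Option ((Fin b → ℚ) × ℚ)) (lo hi : Fin k → Fin k ⊕ ((Fin b → ℚ) × ℚ)), Bornology.IsBounded s.domain ∧ s.domain = {z | (∀ j, 0 < ∑ i, ((M j).1 i : ℝ) * z (Fin.castAdd k i) + ((M j).2 : ℝ)) ∧ ∀ i, Sum.elim (fun j => z (Fin.natAdd b j)) (fun c => ∑ i', (c.1 i' : ℝ) * z (Fin.castAdd k i') + (c.2 : ℝ)) (lo i) < z (Fin.natAdd b i) ∧ z (Fin.natAdd b i) < Sum.elim (fun j => z (Fin.natAdd b j)) (fun c => ∑ i', (c.1 i' : ℝ) * z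 (Fin.castAdd k i') + (c.2 : ℝ)) (hi i)} ∧ EqOn s.integrand (fun z => MvPolynomial.aeval (fun i => z (Fin.castAdd k i)) p / (∏ j, (∑ i, ((L j).1 i : ℝ) * z (Fin.castAdd k i) + ((L j).2 : ℝ)) ^ e j) * ∏ i, (a i).elim 1 (fun c => 1 / (z (Fin.natAdd b i) - (∑ i', (c.1 i' : ℝ) * z (Fin.castAdd k i') + (c.2 : ℝ))))) s.domain ∧ w = KZ.of s}) (hJD : ∀ N, JD N = {w : KZ.FormalRep | ∃ b' k', b' + k' = N ∧ w ∈ JJ b' k'}) (b : ℕ) (ε : ℚ) (hε : 0 < ε) (HUQ : ∀ (m : ℕ) (L : Fin m → (Fin (b + 1 + 1) → ℚ) × ℚ) (e : Fin m → ℕ) (ℓ₁ ℓ₂ : (Fin (b + 1 + 1) → ℚ) × ℚ) (p : MvPolynomial (Fin (b + 1 + 1)) ℚ) (u v : (Fin (b + 1 + 1 + 1) → ℚ) × ℚ), u.1 (Fin.last (b + 1 + 1)) ≠ 0 → u.1 (Fin.last (b + 1 + 1)) = v.1 (Fin.last (b + 1 + 1)) → ∀ (m'' m₀' : ℕ) (s'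 : KZ.IntegralRep ((b + 1 + 1) + 1 + 1)) (M' : Fin m'' → (Fin (b + 1 + 1 + 1) → ℚ) × ℚ) (M₀' : Fin m₀' → (Fin (b + 1 + 1) → ℚ) × ℚ) (ylo' yhi' : (Fin (b + 1 + 1) → ℚ) × ℚ), Bornology.IsBounded s'.domain → s'.domain = SeparatePos.gDom (b + 1 + 1) 1 m'' M' (fun _ => Sum.inr u) (fun _ => Sum.inr v) → EqOn s'.integrand (RebasePos.glit (b + 1 + 1) 1 p L e ℓ₁ ℓ₂ 0 1 (fun _ => some 0)) s'.domain → (∀ z : Fin (b + 1 + 1 + 1 + 1) → ℝ, (∀ j, 0 < SeparatePos.affF (b + 1 + 1) 1 (M' j) z) → 0 < SeparatePos.affF (b + 1 + 1) 1 u z ∧ SeparatePos.affF (b + 1 + 1) 1 u z < SeparatePos.affF (b + 1 + 1) 1 v z) → (∀ z : Fin (b + 1 + 1 + 1 + 1) → ℝ, (∀ j, 0 < SeparatePos.affF (b + 1 + 1) 1 (M' j) z) ↔ ((∀ j, 0 < SeparatePos.affB (b + 1 + 1) 1 (M₀' j) z) ∧ SeparatePos.affB (b + 1 + 1) 1 ylo'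 z < z (Fin.castAdd 1 (Fin.last (b + 1 + 1))) ∧ z (Fin.castAdd 1 (Fin.last (b + 1 + 1))) < SeparatePos.affB (b + 1 + 1) 1 yhi' z)) → (∀ z : Fin (b + 1 + 1 + 1 + 1) → ℝ, (∀ j, 0 < SeparatePos.affB (b + 1 + 1) 1 (M₀' j) z) → SeparatePos.affB (b + 1 + 1) 1 ylo' z < SeparatePos.affB (b + 1 + 1) 1 yhi' z) → (∀ z : Fin (b + 1 + 1 + 1 + 1) → ℝ, (∀ j, 0 < SeparatePos.affB (b + 1 + 1) 1 (M₀' j) z) → (0 < u.1 (Fin.last (b + 1 + 1)) → SeparatePos.affB (b + 1 + 1) 1 ℓ₂ z ≤ SeparatePos.affB (b + 1 + 1) 1 ylo' z) ∧ (u.1 (Fin.last (b + 1 + 1)) < 0 → SeparatePos.affB (b + 1 + 1) 1 yhi' z ≤ SeparatePos.affB (b + 1 + 1) 1 ℓ₂ z)) → (∀ z : Fin (b + 1 + 1 + 1 + 1) → ℝ, (∀ j, 0 < SeparatePos.affB (b + 1 + 1) 1 (M₀' j) z) → SeparatePos.affF (b + 1 + 1) 1 v z - SeparatePos.affF (b +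 1 + 1) 1 u z < ε * (SeparatePos.affB (b + 1 + 1) 1 yhi' z - SeparatePos.affB (b + 1 + 1) 1 ylo' z)) → ((∃ δ : ℝ, 0 < δ ∧ ∀ z : Fin (b + 1 + 1 + 1 + 1) → ℝ, (∀ j, 0 < SeparatePos.affB (b + 1 + 1) 1 (M₀' j) z) → δ ≤ |SeparatePos.affB (b + 1 + 1) 1 ylo' z - SeparatePos.affB (b + 1 + 1) 1 ℓ₂ z| ∧ δ ≤ |SeparatePos.affB (b + 1 + 1) 1 yhi' z - SeparatePos.affB (b + 1 + 1) 1 ℓ₂ z|) ∧ (∃ z ∈ closure {z : Fin (b + 1 + 1 + 1 + 1) → ℝ | ∀ j, 0 < SeparatePos.affF (b + 1 + 1) 1 (M' j) z}, SeparatePos.affB (b + 1 + 1) 1 ylo' z = SeparatePos.affB (b + 1 + 1) 1 yhi' z ∧ SeparatePos.affF (b + 1 + 1) 1 u z = SeparatePos.affF (b + 1 + 1) 1 v z ∧ SeparatePos.affB (b + 1 + 1) 1 (SeparatePos.restr (b + 1 + 1) u) z + (u.1 (Fin.last (b + 1 + 1)) : ℝ) * SeparatePos.affB (b + 1 + 1)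 1 ℓ₂ z = 0)) ∨ (∃ z ∈ closure {z : Fin (b + 1 + 1 + 1 + 1) → ℝ | ∀ j, 0 < SeparatePos.affF (b + 1 + 1) 1 (M' j) z}, SeparatePos.affB (b + 1 + 1) 1 ylo' z = SeparatePos.affB (b + 1 + 1) 1 yhi' z ∧ SeparatePos.affF (b + 1 + 1) 1 u z = SeparatePos.affF (b + 1 + 1) 1 v z ∧ SeparatePos.affB (b + 1 + 1) 1 (SeparatePos.restr (b + 1 + 1) u) z + (u.1 (Fin.last (b + 1 + 1)) : ℝ) * SeparatePos.affB (b + 1 + 1) 1 ℓ₂ z = 0 ∧ SeparatePos.affB (b + 1 + 1) 1 ylo' z = SeparatePos.affB (b + 1 + 1) 1 ℓ₂ z) → ∃ c ∈ AddSubgroup.closure (SeparatePos.GGset (b + 1 + 1) 2 1), KZ.of s' - c ∈ KZ.relations) (Hdthick : ∀ (m : ℕ) (L : Fin m → (Fin (b + 1 + 1) → ℚ) × ℚ) (e : Fin m → ℕ) (ℓ₁ ℓ₂ : (Fin (b + 1 + 1) → ℚ) × ℚ), ∀ (m' : ℕ) (s : KZ.IntegralRep (b + 1 + 1 + 1 +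 1)) (M : Fin m' → (Fin (b + 1 + 1 + 1) → ℚ) × ℚ) (p : MvPolynomial (Fin (b + 1 + 1)) ℚ) (u v κ : (Fin (b + 1 + 1 + 1) → ℚ) × ℚ) (A : ℚ), Bornology.IsBounded s.domain → s.domain = SeparatePos.gDom (b + 1 + 1) 1 m' M (fun _ => Sum.inr u) (fun _ => Sum.inr v) → EqOn s.integrand (RebasePos.glit (b + 1 + 1) 1 p L e ℓ₁ ℓ₂ 0 1 (fun _ => some 0)) s.domain → κ.1 (Fin.last (b + 1 + 1)) = 0 → u - κ = A • (v - u) → 0 < A → (∀ z : Fin (b + 1 + 1 + 1 + 1) → ℝ, (∀ j, 0 < SeparatePos.affF (b + 1 + 1) 1 (M j) z) → SeparatePos.affF (b + 1 + 1) 1 κ z < 0 ∧ 0 < SeparatePos.affF (b + 1 + 1) 1 u z ∧ SeparatePos.affF (b + 1 + 1) 1 u z < SeparatePos.affF (b + 1 + 1) 1 v z) → (∃ z ∈ closure {z : Fin (b + 1 + 1 + 1 + 1) → ℝ | ∀ j, 0 < SeparatePos.affF (b + 1 + 1) 1 (M j) z}, SeparatePos.affF (b + 1 + 1) 1 κ z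 = 0 ∧ SeparatePos.affF (b + 1 + 1) 1 u z = 0 ∧ SeparatePos.affF (b + 1 + 1) 1 v z = 0 ∧ z (Fin.castAdd 1 (Fin.last (b + 1 + 1))) = SeparatePos.affB (b + 1 + 1) 1 ℓ₂ z) → ∃ c ∈ AddSubgroup.closure (SeparatePos.GGset (b + 1 + 1) 2 1), KZ.of s - c ∈ KZ.relations) (Hdfar : ∀ (m : ℕ) (L : Fin m → (Fin (b + 1 + 1) → ℚ) × ℚ) (e : Fin m → ℕ) (ℓ₁ ℓ₂ : (Fin (b + 1 + 1) → ℚ) × ℚ), ∀ (m' : ℕ) (s : KZ.IntegralRep (b + 1 + 1 + 1 + 1)) (M : Fin m' → (Fin (b + 1 + 1 + 1) → ℚ) × ℚ) (p : MvPolynomial (Fin (b + 1 + 1)) ℚ) (u v κ : (Fin (b + 1 + 1 + 1) → ℚ) × ℚ) (A : ℚ), Bornology.IsBounded s.domain → s.domain = SeparatePos.gDom (b + 1 + 1) 1 m' M (fun _ => Sum.inr u) (fun _ => Sum.inr v) → EqOn s.integrand (RebasePos.glit (b + 1 + 1) 1 p L e ℓ₁ ℓ₂ 0 1 (fun _ =>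 some 0)) s.domain → κ.1 (Fin.last (b + 1 + 1)) = 0 → u - κ = A • (v - u) → 0 < A → (∀ z : Fin (b + 1 + 1 + 1 + 1) → ℝ, (∀ j, 0 < SeparatePos.affF (b + 1 + 1) 1 (M j) z) → 0 < SeparatePos.affF (b + 1 + 1) 1 κ z ∧ SeparatePos.affF (b + 1 + 1) 1 u z < SeparatePos.affF (b + 1 + 1) 1 v z ∧ 2 * SeparatePos.affF (b + 1 + 1) 1 κ z ≤ SeparatePos.affF (b + 1 + 1) 1 v z) → (∃ z ∈ closure {z : Fin (b + 1 + 1 + 1 + 1) → ℝ | ∀ j, 0 < SeparatePos.affF (b + 1 + 1) 1 (M j) z}, SeparatePos.affF (b + 1 + 1) 1 κ z = 0 ∧ SeparatePos.affF (b + 1 + 1) 1 u z = 0 ∧ SeparatePos.affF (b + 1 + 1) 1 v z = 0 ∧ z (Fin.castAdd 1 (Fin.last (b + 1 + 1))) = SeparatePos.affB (b + 1 + 1) 1 ℓ₂ z) → ∃ c ∈ AddSubgroup.closure (SeparatePos.GGset (b + 1 + 1) 2 1), KZ.of s - c ∈ KZ.relations) : ∀ x ∈ GS (b + 2) 1, ∃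 c ∈ AddSubgroup.closure (GG (b + 2) 2 1 ∪ JJ (b + 2) 2 ∪ JD (b + 3)), x - c ∈ KZ.relations :=
  rebaseSimplePosOnePos_of_triple' GS GG hGS hGG JJ JD hJJ hJD b
    (fun m L e ℓ₁ ℓ₂ _ _ s M M₀ ylo yhi p u v hbd hdom hint hu hpar hcell hsec _ =>
      RebasePos.good_parCell_of_thinQuad' L e ℓ₁ ℓ₂ ε hε s M M₀ ylo yhi p u v hbd hdom hint hu hpar hcell hsec
        (fun m'' m₀' s' M' M₀' ylo' yhi' hbd' hdom' hint' hcell' hsec' hne' hfar' hthin' hδ htr =>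
          HUQ m L e ℓ₁ ℓ₂ p u v hu hpar m'' m₀' s' M' M₀' ylo' yhi' hbd' hdom' hint' hcell' hsec' hne' hfar' hthin'
            (Or.inl ⟨hδ, htr⟩))
        (fun m'' m₀' s' M' M₀' ylo' yhi' hbd' hdom' hint' hcell' hsec' hne' hfar' hthin' hq =>
          HUQ m L e ℓ₁ ℓ₂ p u v hu hpar m'' m₀' s' M' M₀' ylo' yhi' hbd' hdom' hint' hcell' hsec' hne' hfar' hthin'
            (Or.inr hq)))
    Hdthick Hdfar

end Summit.KontsevichZagierPeriods.ArrangementNormalForm.JanusBands
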